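import Summits.ABC.ABC.Theses.IsogenyGlueCongruence
import Literature.NumberTheory.DiophantineGeometry.ValuationProductElliptic
import Literature.NumberTheory.DiophantineGeometry.EllArithGlueProofs

/-!
# `PolyHeightOfBoundedPrimes` (stmt-ABC-16006, crux B′) — line `Sketch` (card `archimedean-hall-split`):
the registered CALIBRATION stub `stub_primeConductorRung` (prime-conductor rung)

Crux `B′ = A → H` of route IsogenyGlueCongruence (`H`: `max(|Δ_W|, |c₄(W)|³) ≤ C·N_W^σ` on semistable
global minimal elliptic `W/ℚ`). The line splits `H` into a finite half (`|Δ_W| ≤ C·N_W^σ`) and a Hall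
half (`|c₄(W)|³ ≤ C·|Δ_W|^{σ'}`). Modulo the named fact
`Literature.NumberTheory.DiophantineGeometry.mestreOesterle1989_thm_1` (prime conductor ⟹ `Δ_min ∣ N⁵`,
Mestre–Oesterlé 1989 / Knapp Thm 12.11; a Literature `def … : Prop`, taken here as an explicit hypothesis,
NOT discharged) the finite half is known at prime conductor with `σ = 5`, so at prime conductor `H`
reduces to the Hall half: a Hall bound `|c₄|³ ≤ C·|Δ|^{σ'}` (`0 ≤ σ'`, `0 ≤ C`) on prime-conductor
global minimal models gives `max(|Δ|, |c₄|³) ≤ max(1, C) · N^{5·max(σ',1)}`.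

Proof: on a global minimal model `|Δ(W)| = N(𝔇_min)`
(`WeierstrassCurve.minimalDiscriminantNorm_int_eq_natAbs_minimalDiscriminantInt_holds`,
`WeierstrassCurve.cast_minimalDiscriminantInt`); Mestre–Oesterlé gives `N(𝔇_min) ∣ N⁵`, so
`|Δ| ≤ N⁵ ≤ N^{5 max(σ',1)}` and `|c₄|³ ≤ C|Δ|^{σ'} ≤ C N^{5σ'} ≤ max(1,C) N^{5 max(σ',1)}` (`N ≥ 2`).
CONDITIONAL bridge (supports stmt-ABC-16006; closes nothing).
-/

noncomputable section

-- single-conjunct summit ABC: the duplicate ABC.ABC is mandated (CONVENTIONS §2)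
set_option linter.dupNamespace false

namespace Summit.ABC.ABC.Theorems.PolyHeightOfBoundedPrimes.HallSplit

open WeierstrassCurve IsDedekindDomain
open Summit.ABC.ABC.Theses.IsogenyGlueCongruence

/-- **CALIBRATION STUB (prime-conductor rung; registered on stmt-ABC-16006, line `Sketch`).** Modulo the
named fact `Literature.NumberTheory.DiophantineGeometry.mestreOesterle1989_thm_1` (prime conductor ⟹
`Δ_min ∣ N⁵`, taken as an explicit hypothesis) the finite half of `H` is known at prime conductor
(`σ = 5`), so there `H` reduces to the Hall half: a Hall bound `|c₄|³ ≤ C·|Δ|^{σ}` on prime-conductor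
global minimal models gives `max(|Δ|, |c₄|³) ≤ max(1, C) · N^{5·max(σ,1)}`.
[cite: MestreOesterle1989, Théorème 1] -/
theorem stub_primeConductorRung :
    Literature.NumberTheory.DiophantineGeometry.mestreOesterle1989_thm_1 →
    ∀ σ C : ℝ, 0 ≤ σ → 0 ≤ C →
      (∀ (W : WeierstrassCurve ℚ) [W.IsElliptic] [W.IsGloballyMinimal],
        (W.conductorNorm ℤ).Prime → ((|W.c₄| ^ 3 : ℚ) : ℝ) ≤ C * ((|W.Δ| : ℚ) : ℝ) ^ σ) →
      ∀ (W : WeierstrassCurve ℚ) [W.IsElliptic] [W.IsGloballyMinimal],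
        (W.conductorNorm ℤ).Prime →
          ((max |W.Δ| (|W.c₄| ^ 3) : ℚ) : ℝ) ≤ max 1 C * (W.conductorNorm ℤ : ℝ) ^ (5 * max σ 1) := by
  intro hMO σ C hσ hC hHall W _ _ hp
  -- (i) on a global minimal model `|Δ(W)| = N(𝔇_min)` (as real numbers)
  have hΔeq : ((|W.Δ| : ℚ) : ℝ) = ((W.minimalDiscriminantNorm ℤ : ℕ) : ℝ) := by
    rw [WeierstrassCurve.minimalDiscriminantNorm_int_eq_natAbs_minimalDiscriminantInt_holds W,
      ← WeierstrassCurve.cast_minimalDiscriminantInt W, Rat.cast_abs, Rat.cast_intCast,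
      Nat.cast_natAbs, Int.cast_abs]
  -- (ii) Mestre–Oesterlé: `N(𝔇_min) ∣ N⁵` with `N` prime, hence `N(𝔇_min) ≤ N⁵`
  have hle : W.minimalDiscriminantNorm ℤ ≤ (W.conductorNorm ℤ) ^ 5 :=
    Nat.le_of_dvd (pow_pos hp.pos 5) (hMO W hp)
  set N : ℝ := (W.conductorNorm ℤ : ℝ) with hNdef
  have hN1 : (1 : ℝ) ≤ N := by rw [hNdef]; exact_mod_cast hp.one_lt.le
  have hN0 : (0 : ℝ) ≤ N := zero_le_one.trans hN1
  have hΔ5 : ((|W.Δ| : ℚ) : ℝ) ≤ N ^ ((5 : ℕ) : ℝ) := by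
    rw [Real.rpow_natCast, hΔeq, hNdef]
    exact_mod_cast hle
  have hΔ0 : (0 : ℝ) ≤ ((|W.Δ| : ℚ) : ℝ) := by exact_mod_cast abs_nonneg _
  have h5le : ((5 : ℕ) : ℝ) ≤ 5 * max σ 1 := by
    have := le_max_right σ 1
    push_cast
    linarith
  have h5σle : ((5 : ℕ) : ℝ) * σ ≤ 5 * max σ 1 := by
    have := le_max_left σ 1
    push_cast
    linarith
  have hpow0 : (0 : ℝ) ≤ N ^ (5 * max σ 1) := Real.rpow_nonneg hN0 _
  have hC' : C ≤ max 1 C := le_max_right _ _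
  have h1' : (1 : ℝ) ≤ max 1 C := le_max_left _ _
  -- finite half at prime conductor: `|Δ| ≤ N⁵ ≤ max(1,C) · N^{5 max(σ,1)}`
  have eΔ : ((|W.Δ| : ℚ) : ℝ) ≤ max 1 C * N ^ (5 * max σ 1) :=
    calc ((|W.Δ| : ℚ) : ℝ) ≤ N ^ ((5 : ℕ) : ℝ) := hΔ5
      _ ≤ N ^ (5 * max σ 1) := Real.rpow_le_rpow_of_exponent_le hN1 h5le
      _ = 1 * N ^ (5 * max σ 1) := (one_mul _).symm
      _ ≤ max 1 C * N ^ (5 * max σ 1) := mul_le_mul_of_nonneg_right h1' hpow0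
  -- Hall half transported along `|Δ| ≤ N⁵`: `|c₄|³ ≤ C|Δ|^σ ≤ C N^{5σ} ≤ max(1,C) · N^{5 max(σ,1)}`
  have ec : ((|W.c₄| ^ 3 : ℚ) : ℝ) ≤ max 1 C * N ^ (5 * max σ 1) :=
    calc ((|W.c₄| ^ 3 : ℚ) : ℝ) ≤ C * ((|W.Δ| : ℚ) : ℝ) ^ σ := hHall W hp
      _ ≤ C * (N ^ ((5 : ℕ) : ℝ)) ^ σ :=
        mul_le_mul_of_nonneg_left (Real.rpow_le_rpow hΔ0 hΔ5 hσ) hC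
      _ = C * N ^ (((5 : ℕ) : ℝ) * σ) := by rw [← Real.rpow_mul hN0]
      _ ≤ C * N ^ (5 * max σ 1) :=
        mul_le_mul_of_nonneg_left (Real.rpow_le_rpow_of_exponent_le hN1 h5σle) hC
      _ ≤ max 1 C * N ^ (5 * max σ 1) := mul_le_mul_of_nonneg_right hC' hpow0
  rw [Rat.cast_max]
  exact max_le eΔ ec

end Summit.ABC.ABC.Theorems.PolyHeightOfBoundedPrimes.HallSplit

end
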